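import Summits.HodgeConjecture.HodgeConjecture.Theorems.R90S1BranchBEndAssemblyRamified      -- ★ (this seat) `exists_eta_of_det_eq_zero_of_pairEntries_ram` (frame-free end assembly at a ramified place)
import Summits.HodgeConjecture.HodgeConjecture.Theorems.R90S1BranchBConstantsRamified        -- ★∕📤 (this seat) `norm_apply_norm_uniformizer_lt_one` (`hX`), `integral_weyl_weyl_eq_ram` (`h1wv`); brings ★ `K2E3KeysThmTwoDepthZeroBranchBConstants` §2–§3 (place-generic `hV`, `hw1v`)
import Literature.NumberTheory.Rogawski1990.RankOneUnstableDeltaValueRamified                  -- ★ `Rogawski1990.absNorm_placesOver_eq_of_ramified` (`N𝔓_w = N𝔭_v`)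
import HarnessLib

/-!
# R90 · S1 ∕ U4Keys leaf (U4f-χ₁-ram-one-d0B) — THE END ASSEMBLY FROM `det M = 0` AT A RAMIFIED PLACE, BIG-CELL FORM ON `U(Φ₃)(L⁺_v)`: `det M = 0` on the four integrals + the two
# BIG-CELL entries `Λ_1 f₁ = c₀·((q−1)∕q)·μ(N₀)·X∕(1−X)`, `Λ_{w₀} f_w = c₀·((q−1)∕q)·μ(N₀)∕(1−X)` (`X = χ₁(σΠ·Π)`) ⟹ `χ₁ = η·‖·‖^{1∕2}`, `η|_{F^×} = ω_{E∕F}`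
# [Keys1984 §7 Thm (2) (d); Casselman1980 §3; PAPER-Z3-DepthZeroRamified §1–§2 (R90-C10-p05 (g0), r01-screened)]

Cell `hodgecm-mathlib`, SLAB R90-TF, section S1 «Ch. 12 local», crux H413 = `stmt-HodgeConjecture-24833` (lane `--supports … --as helper`), route HCCMUnconditional; prover seat
`hodgecm-mathlib-R90-C10-p05` (g0); socket of record S1#3′ = K2E3 leaf (U4f-χ₁-ram-one) ⊇ U4Keys :155 (depth 0, Branch B).  THEOREMS ONLY (no definition ∕ instance ∕ notation ∕
named fact ∕ `sorry`); ★-only imports.  The RAMIFIED twin of ★ `K2E3KeysThmTwoDepthZeroBranchBFromDet.exists_eta_of_det_eq_zero_of_bigCellEntries` (§2, inert), in the SAME (G3) frame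
`L v w hw eA heA ϖ hϖ g₁ hg₁ K0 K1 I hK0 hK1 hI`: the constant entries `Λ_1 f_w = μ(N₀)` (★ `integral_weyl_one_eq`, place-generic) and `Λ_{w₀} f₁ = q⁻¹μ(N₀)` (★∕📤
`integral_weyl_weyl_eq_ram`), `μ(N₀) ≠ 0` (★ `measureReal_setOf_mem_ne_zero`), `|X| < 1` (★∕📤 `norm_apply_norm_uniformizer_lt_one`) are discharged; `q = N𝔭_v = N𝔓_w` (★
`absNorm_placesOver_eq_of_ramified`).
* **`exists_eta_of_det_eq_zero_of_bigCellEntries_ram`**.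
WHAT REMAINS for :155 at a tame ramified odd `v`: `det M = 0` from reducibility (★ Z2-B `K2E3BranchBDeterminantZeroDepthZero` + the type vector + the type basis ★ `K2E3BranchBTypeBasisCM`, to be
re-read at `e = 2`) and the two big-cell entries `h11v`, `hwwv` (the two ramified shell pieces, paper §1 — the (II)-a∕b∕c twins).
HONEST LABEL: HC_CM is proved only modulo the 7 printed citations (2 remaining named inputs: hLiu418 = `stmt-HodgeConjecture-24832`, h413 = `stmt-HodgeConjecture-24833`) until rung 0
closes; count-neutral — this file does NOT pay the leaf; no printed citation is discharged.

## References
* [Keys1984] D. Keys, *Principal series representations of special unitary groups over local fields*, Compositio Math. 51 (1984), §3, §7 Theorem (2) (d) p. 126.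
* [Casselman1980] W. Casselman, *The unramified principal series of p-adic groups I*, Compositio Math. 40 (1980), §3.
* [Rogawski1990] J. D. Rogawski, *Automorphic Representations of Unitary Groups in Three Variables*, Ann. of Math. Stud. 123 (1990), §12.2 (1)–(2) p. 173.
-/

set_option autoImplicit false
-- the mandated namespace has the single-problem summit's repeated segment (`HodgeConjecture.HodgeConjecture`)
set_option linter.dupNamespace false

noncomputable section

open NumberField IsDedekindDomain MeasureTheory
open scoped Matrix MatrixGroups WithZero Valued NNReal
open Literature.NumberTheory Literature.NumberTheory.Automorphic Literature.NumberTheory.Automorphic.UnitaryGroup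
open Literature.NumberTheory.Rogawski1990

namespace Summit.HodgeConjecture.HodgeConjecture.R90.S1

open Summit.HodgeConjecture.HodgeConjecture.Cruxes.H413
open Summit.HodgeConjecture.HodgeConjecture.Cruxes.H413.K2E3DepthZeroIwahoriCharacterCM
open Summit.HodgeConjecture.HodgeConjecture.Cruxes.H413.K2E3BranchATorusWitnessCM
open Summit.HodgeConjecture.HodgeConjecture.Cruxes.H413.K2E3BranchATypeLettersCM

variable (L : Type) [Field L] [NumberField L] [IsCMField L] (v : HeightOneSpectrum (𝓞 ↥(maximalRealSubfield L)))
  (w : PlacesOver L v) (hw : IsCMField.complexConj L • w.1 = w.1)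
  (eA : Gqs L v ≃ₜ* ↥(unitaryGroupOfForm (galAdicCompletionMap (L := L) (IsCMField.complexConj L) hw) ((StdForm.antidiagonal 3).over (w.1.adicCompletion L))))
  (heA : ∀ g : Gqs L v,
    ((eA g : ↥(unitaryGroupOfForm (galAdicCompletionMap (L := L) (IsCMField.complexConj L) hw) ((StdForm.antidiagonal 3).over (w.1.adicCompletion L)))) :
        GL (Fin 3) (w.1.adicCompletion L)) =
      ((localNonsplitEquiv (IsCMField.complexConj L) (qsForm L) (IsCMField.complexConj_ne_one L) w hw g :
        ↥(unitaryGroupOfForm (galAdicCompletionMap (L := L) (IsCMField.complexConj L) hw) (placeForm (qsForm L) w.1))) : GL (Fin 3) (w.1.adicCompletion L)))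
  {ϖ : w.1.adicCompletion L} (hϖ : Valued.v ϖ = WithZero.exp (-1 : ℤ))
  (g₁ : GL (Fin 3) (w.1.adicCompletion L)) (hg₁ : (g₁ : Matrix (Fin 3) (Fin 3) (w.1.adicCompletion L)) = Matrix.diagonal ![(1 : w.1.adicCompletion L), 1, ϖ])
  (K0 K1 I : Subgroup (Gqs L v))
  (hK0 : K0 = ((glInt 3 (w.1.adicCompletion L)).subgroupOf
    (unitaryGroupOfForm (galAdicCompletionMap (L := L) (IsCMField.complexConj L) hw) ((StdForm.antidiagonal 3).over (w.1.adicCompletion L)))).comap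
      eA.toMulEquiv.toMonoidHom)
  (hK1 : K1 = (((glInt 3 (w.1.adicCompletion L)).map (MulAut.conj g₁).toMonoidHom).subgroupOf
    (unitaryGroupOfForm (galAdicCompletionMap (L := L) (IsCMField.complexConj L) hw) ((StdForm.antidiagonal 3).over (w.1.adicCompletion L)))).comap
      eA.toMulEquiv.toMonoidHom)
  (hI : I = K0 ⊓ K1)

/-! ## On `U(Φ₃)(L⁺_v)` at a ramified place: `det M = 0` + the two big-cell entries ⟹ `χ₁ = η · ‖·‖^{1∕2}` -/

open Classical in
include hw heA hϖ hg₁ hK0 hK1 hI in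
set_option maxHeartbeats 4000000 in
set_option synthInstance.maxHeartbeats 400000 in
-- the `SmoothInd` carrier on `U(Φ₃)(L⁺_v)` (class of ★ `K2E3KeysThmTwoDepthZeroBranchBFromDet.exists_eta_of_det_eq_zero_of_bigCellEntries`)
/-- **THE END ASSEMBLY FROM `det M = 0` AT A RAMIFIED PLACE, BIG-CELL FORM ON `U(Φ₃)(L⁺_v)`.**  In the (G3)-frame with `w₀` the element of matrix `Φ₃` and a Haar `μ` on `N(L⁺_v)`: `v` non-split,
`w ∣ v` RAMIFIED (`he`) with `|2|_w = 1`; `Π` a uniformiser unit of `E_v`, `X := χ₁(σΠ·Π)`; `χ₁` continuous, contracting, with :155's letters `hdepth`, `hB`, `hram`; `(f₁, f_w)` a normalised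
`(I, χ̃)`-type basis of `i(χ₁, 1)`; a sign `c₀² = 1`; the two BIG-CELL entries `Λ_1 f₁ = c₀·((q−1)∕q)·μ(N₀)·X∕(1−X)`, `Λ_{w₀} f_w = c₀·((q−1)∕q)·μ(N₀)∕(1−X)` (`q = N𝔭_v`; paper §1: even
shells only) and `det M = 0` on the four integrals.  Then **`χ₁ = η · ‖·‖^{1∕2}`, `η` a continuous quadratic character extension** — ★ frame-free end assembly
`exists_eta_of_det_eq_zero_of_pairEntries_ram` with `V := μ(N₀)`, the constant entries `Λ_1 f_w = μ(N₀)` ★ `integral_weyl_one_eq`, `Λ_{w₀} f₁ = q⁻¹μ(N₀)` ★ `integral_weyl_weyl_eq_ram`,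
`μ(N₀) ≠ 0` ★ `measureReal_setOf_mem_ne_zero`, `|X| < 1` ★ `norm_apply_norm_uniformizer_lt_one`, `N𝔓_w = N𝔭_v` ★ `absNorm_placesOver_eq_of_ramified`.
[cite: Keys1984, §7 Theorem (2) (d) p. 126] [cite: Casselman1980, §3] [cite: Rogawski1990, §12.2 (1)–(2) p. 173] -/
theorem exists_eta_of_det_eq_zero_of_bigCellEntries_ram
    (hns : ∀ w' : PlacesOver L v, IsCMField.complexConj L • w'.1 = w'.1)
    (he : v.asIdeal.ramificationIdx' w.1.asIdeal ≠ 1) (h2w : Valued.v (2 : w.1.adicCompletion L) = 1)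
    (piU : (LocalRing L v)ˣ) (hpiU : ∀ w' : PlacesOver L v, Valued.v ((piU : LocalRing L v) w') = WithZero.exp (-1 : ℤ))
    (χ₁ : (LocalRing L v)ˣ →* ℂˣ) (h₁ : Continuous fun x => ((χ₁ x : ℂˣ) : ℂ))
    (hcontr : ∀ x : (LocalRing L v)ˣ, unitModulusChar (LocalRing L v) x < 1 → ‖((χ₁ x : ℂˣ) : ℂ)‖ < 1)
    (hdepth : ∀ u : (LocalRing L v)ˣ, (∀ w' : PlacesOver L v, Valued.v (((u : LocalRing L v) w') - 1) < 1) → χ₁ u = 1)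
    (hB : ∀ u : (LocalRing L v)ˣ, (∀ w' : PlacesOver L v, Valued.v ((u : LocalRing L v) w') = 1) →
      χ₁ (u * Units.map (conjLocal L (IsCMField.complexConj L) v : LocalRing L v →* LocalRing L v) u) = 1)
    (hram : ¬ ∀ u ∈ (Submonoid.pi Set.univ (fun w' : PlacesOver L v => (w'.1.adicCompletionIntegers L).toSubring.toSubmonoid)).units, χ₁ u = 1)
    (w₀ : ↥(unitaryGroupOfForm (conjLocal L (IsCMField.complexConj L) v) (cmLocalForm L 3 v))) (hw₀ : Units.val (w₀ : GL (Fin 3) (LocalRing L v)) = cmLocalForm L 3 v)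
    [instM : MeasurableSpace ↥(cmBorelTriple L 3 v).N] [instB : BorelSpace ↥(cmBorelTriple L 3 v).N] (μ : Measure ↥(cmBorelTriple L 3 v).N) [instH : μ.IsHaarMeasure]
    (f₁ f_w : haveI := locallyCompactSpace_cmBorelU L 3 v
      Representation.SmoothInd (cmBorelTriple L 3 v).P
        (Representation.twist (((Representation.trivial ℂ ↥(torusU (conjLocal L (IsCMField.complexConj L) v) (cmLocalForm L 3 v)) ℂ).twist
          (cmTorusCharPair L v χ₁ 1)).comp (cmBorelTriple L 3 v).proj) (rootDeltaChar (cmBorelTriple L 3 v).P)))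
    (heig₁ : ∀ x ∈ I, (haveI := locallyCompactSpace_cmBorelU L 3 v; Representation.smoothIndRep _ _ x f₁) = (if h : IsUnit (((x.val : GL (Fin 3) (LocalRing L v)) : Matrix (Fin 3) (Fin 3) (LocalRing L v)) 0 0) then ((χ₁ h.unit : ℂˣ) : ℂ) else 0) • f₁)
    (heig_w : ∀ x ∈ I, (haveI := locallyCompactSpace_cmBorelU L 3 v; Representation.smoothIndRep _ _ x f_w) = (if h : IsUnit (((x.val : GL (Fin 3) (LocalRing L v)) : Matrix (Fin 3) (Fin 3) (LocalRing L v)) 0 0) then ((χ₁ h.unit : ℂˣ) : ℂ) else 0) • f_w)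
    (h11 : f₁.toFun 1 = 1) (h1g : f₁.toFun w₀ = 0) (hw1 : f_w.toFun 1 = 0) (hwg : f_w.toFun w₀ = 1)
    (c₀ : ℂ) (hc : c₀ ^ 2 = 1)
    (h11v : ∫ n : ↥(cmBorelTriple L 3 v).N, f₁.toFun (w₀ * (n : ↥(unitaryGroupOfForm (conjLocal L (IsCMField.complexConj L) v) (cmLocalForm L 3 v))) * 1) ∂μ =
      c₀ * ((((Ideal.absNorm v.asIdeal : ℝ) : ℂ) - 1) / ((Ideal.absNorm v.asIdeal : ℝ) : ℂ) * ((μ.real {m : ↥(cmBorelTriple L 3 v).N | (m : ↥(unitaryGroupOfForm (conjLocal L (IsCMField.complexConj L) v) (cmLocalForm L 3 v))) ∈ I} : ℝ) : ℂ) *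
        ((χ₁ (Units.map (conjLocal L (IsCMField.complexConj L) v : LocalRing L v →* LocalRing L v) piU * piU) : ℂˣ) : ℂ) /
          (1 - ((χ₁ (Units.map (conjLocal L (IsCMField.complexConj L) v : LocalRing L v →* LocalRing L v) piU * piU) : ℂˣ) : ℂ))))
    (hwwv : ∫ n : ↥(cmBorelTriple L 3 v).N, f_w.toFun (w₀ * (n : ↥(unitaryGroupOfForm (conjLocal L (IsCMField.complexConj L) v) (cmLocalForm L 3 v))) * w₀) ∂μ =
      c₀ * ((((Ideal.absNorm v.asIdeal : ℝ) : ℂ) - 1) / ((Ideal.absNorm v.asIdeal : ℝ) : ℂ) * ((μ.real {m : ↥(cmBorelTriple L 3 v).N | (m : ↥(unitaryGroupOfForm (conjLocal L (IsCMField.complexConj L) v) (cmLocalForm L 3 v))) ∈ I} : ℝ) : ℂ) /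
        (1 - ((χ₁ (Units.map (conjLocal L (IsCMField.complexConj L) v : LocalRing L v →* LocalRing L v) piU * piU) : ℂˣ) : ℂ))))
    (hdet : (∫ n : ↥(cmBorelTriple L 3 v).N, f₁.toFun (w₀ * (n : ↥(unitaryGroupOfForm (conjLocal L (IsCMField.complexConj L) v) (cmLocalForm L 3 v))) * 1) ∂μ) * (∫ n : ↥(cmBorelTriple L 3 v).N, f_w.toFun (w₀ * (n : ↥(unitaryGroupOfForm (conjLocal L (IsCMField.complexConj L) v) (cmLocalForm L 3 v))) * w₀) ∂μ) - (∫ n : ↥(cmBorelTriple L 3 v).N, f_w.toFun (w₀ * (n : ↥(unitaryGroupOfForm (conjLocal L (IsCMField.complexConj L) v) (cmLocalForm L 3 v))) * 1) ∂μ) * (∫ n : ↥(cmBorelTriple L 3 v).N, f₁.toFun (w₀ * (n : ↥(unitaryGroupOfForm (conjLocal L (IsCMField.complexConj L) v) (cmLocalForm L 3 v))) * w₀) ∂μ) = 0) :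
    ∃ η : (LocalRing L v)ˣ →* ℂˣ, IsQuadraticCharExtension (conjLocal L (IsCMField.complexConj L) v) η ∧
      Continuous (fun x => ((η x : ℂˣ) : ℂ)) ∧ χ₁ = η * halfModulusChar (LocalRing L v) := by
  have hq : Ideal.absNorm w.1.asIdeal = Ideal.absNorm v.asIdeal := absNorm_placesOver_eq_of_ramified L v w hw he
  have h1wv := integral_weyl_weyl_eq_ram L v w hw eA heA hϖ g₁ hg₁ K0 K1 I hK0 hK1 hI χ₁ w₀ hw₀ μ f₁ heig₁ h11 h1g he h2w
  rw [← hq] at h11v hwwv h1wv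
  exact exists_eta_of_det_eq_zero_of_pairEntries_ram L v hns w hw he h2w piU hpiU χ₁ h₁ hdepth hB hram
    ((μ.real {m : ↥(cmBorelTriple L 3 v).N | (m : ↥(unitaryGroupOfForm (conjLocal L (IsCMField.complexConj L) v) (cmLocalForm L 3 v))) ∈ I} : ℝ) : ℂ) c₀
    (∫ n : ↥(cmBorelTriple L 3 v).N, f₁.toFun (w₀ * (n : ↥(unitaryGroupOfForm (conjLocal L (IsCMField.complexConj L) v) (cmLocalForm L 3 v))) * 1) ∂μ) (∫ n : ↥(cmBorelTriple L 3 v).N, f₁.toFun (w₀ * (n : ↥(unitaryGroupOfForm (conjLocal L (IsCMField.complexConj L) v) (cmLocalForm L 3 v))) * w₀) ∂μ) (∫ n : ↥(cmBorelTriple L 3 v).N, f_w.toFun (w₀ * (n : ↥(unitaryGroupOfForm (conjLocal L (IsCMField.complexConj L) v) (cmLocalForm L 3 v))) * 1) ∂μ) (∫ n : ↥(cmBorelTriple L 3 v).N, f_w.toFun (w₀ * (n : ↥(unitaryGroupOfForm (conjLocal L (IsCMField.complexConj L) v) (cmLocalForm L 3 v))) * w₀) ∂μ)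
    (K2E3KeysThmTwoDepthZeroBranchBConstants.measureReal_setOf_mem_ne_zero L v w hw eA g₁ K0 K1 I hK0 hK1 hI μ) hc
    (norm_apply_norm_uniformizer_lt_one L v hns w hw piU hpiU χ₁ hcontr) h11v hwwv
    (K2E3KeysThmTwoDepthZeroBranchBConstants.integral_weyl_one_eq L v w hw eA heA hϖ g₁ hg₁ K0 K1 I hK0 hK1 hI χ₁ w₀ hw₀ μ f_w heig_w hw1 hwg)
    h1wv hdet

end Summit.HodgeConjecture.HodgeConjecture.R90.S1

end
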